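import Summits.QuantumFields.BalabanUV.T4Continuum.Support.NE7BoxPoincareMatrix
import HarnessLib

/-!
# Support | NE7 (gen 96, ROAD-G96 §10, first half of brick B-Hardy): THE LOCAL MASS OF A LATTICE FUNCTION NEAR A BLOCK CORNER —
# `Σ_{[0,L^{s})^d} u² ≤ 4·(L^{s}∕L^{S})^d·Σ_{[0,L^{S})^d} u² + 20·L^{2}·(L^{s})²·Σ_{bonds ⊂ [0,L^{S})^d} (u(x+e_μ) − u(x))²`
# for every `s ≤ S`, every `d`, `L` with `4·L² ≤ L^d` (`d ≥ 4` at `L = 2`): the mass in a corner box of side `r = L^s` is `O(r²)` × the Dirichlet energy of the big box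
# plus the volume share of the big box's mass — k-FREE (dyadic means telescoped with a geometric series, NO logarithm; the scale-critical case d = 4 included)

Cell `pub-balaban`, rung (B)+1 sub-cell t4, lineage `b2b-balaban-t4-ne7-p1` (CRUX PROVER NE7 #1 = OWNER of row NE7), generation 96; memo `t4/b2b-balaban-t4-ne7-p1-g96/ROAD-G96.md`
§10(ii)–(iii).  Over the real cube Poincaré kernel `Beta.CoordCubePoincare.poincare_coordCube` (constant `n(n+1)∕2`, `d`-free) transported to `periodBox` along `boxVec` exactly as in
`NE7BoxPoincareMatrix` (`boxVec_mem_periodBox`, `boxVec_add_e_mem_iff`, `NE3CoarseTorusExact.boxVec_stepUp`, `NE7FlatSliceSourceDuality.sum_periodBox_eq_sum_boxVec`).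

WHY.  ROAD-Γ's absorption step (Γ4) pays the third-order residues of the top-corner gauge adjustment with LOCAL pairings near the top corners; their k- and N-uniformity needs that a
slice field cannot concentrate its ℓ² mass at a corner beyond `r² ×` its energy (memo §10(ii): `dirSq(X₀; 𝒩_r) ≤ C·r²·(gradient energy) + (r∕M)^d·dirSq X₀`, used through its
`max_j` form — the full Hardy sum is not needed).  THIS FILE is the scalar lattice half of that statement: for a real function `u` on the nested corner boxes `B_s = [0, L^s)^d`
(`periodBox (L^s)`; the top corner is the origin; the application takes `u = ‖X₀(·, μ)‖`, whose plain differences are bounded by the covariant differences of `X₀` — reverse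
triangle inequality and unitarity), the mass in `B_s` is bounded by the Dirichlet energy of `B_S` times `20L²·(L^s)²` plus the volume share `4(L^s∕L^S)^d` of the mass of `B_S`.
The proof is the dyadic one WITHOUT annuli: `Σ_{B_s}u² ≤ 2Σ_{B_s}(u − m_s)² + 2|B_s|m_s²`, Poincaré on `B_s`, and the MEANS telescoped `|m_s − m_{s+1}|² ≤ |B_s|⁻¹·Σ_{B_{s+1}}(u − m_{s+1})²
≤ (L²∕2)·L^{(2−d)s}·𝓔` with the weighted Cauchy–Schwarz `(Σ_{t<T} a_t)² ≤ Σ_t 2^{t+1}a_t²` against the geometric gain `2L^{2−d} ≤ 1∕2` — no `log(L^S∕L^s)`.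
WHAT ([folklore]; 0 def, 0 sorry).  §1 real bookkeeping: `sq_sum_le_sum_two_pow_mul_sq`, `sq_avg_mul_card_le`, `sq_avg_sub_le`; the box chart: `periodBox_mono`, `dirichletBox`-free
statement of the transported Poincaré **`poincare_periodBox_real`** (`Σ_{periodBox (m+1)} (u − ū)² ≤ (m(m+1)∕2)·𝓔_{m+1}(u)`, `𝓔_M(u) := Σ_{x ∈ periodBox M} Σ_μ 𝟙(x+e_μ ∈ periodBox M)(u(x+e_μ) − u x)²`,
monotone in the box).  §2 **`cornerLocalMass_le`** (the display above).  §3 (appended) **`cornerLocalMass_covariant_le`**: the same for `dirSq` of a matrix field against its COVARIANT gradient energy at a unitary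
background (`u_κ = ‖Z(·,κ)‖`, reverse triangle inequality, `‖Ad_w a‖ = ‖a‖`).
HONEST FRAMING (page 1): lattice calculus on OUR boxes; nothing of Bałaban's asserted; the slice∕Gaffney half of B-Hardy, (Γ3), (Γ4), `hdecomp♭`, NE7 NOT proved; spine 0∕9; finite T⁴
rung (B)+1 — NOT infinite volume, NOT mass gap, NOT `BetaPertH`, NOT Clay.  Continuum YM on T⁴ ⇐ BetaPertH ∧ nine spine estimates (0/9 proved); BetaPertH ⇐ (D1) ∧ (D4) ∧ CAP+tail;
G-an2-4 gates asym, D1 and NE2/3/4.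
-/

set_option autoImplicit false

open scoped BigOperators
open Finset

namespace Summit.QuantumFields.BalabanUV.T4Continuum.NE7CornerLocalMass

open Literature.MathematicalPhysics.QuantumFieldTheory.Balaban1983to89
open B7Prop1Explicit
open T4AveragingDeficitWallBoundary (periodBox mem_periodBox card_periodBox)
open Beta.CoordCubePoincare (stepUp poincare_coordCube)
open Beta.BlockPoincare (avg)
open NE7FlatSliceSourceDuality (sum_periodBox_eq_sum_boxVec)
open NE3CoarseTorusExact (boxVec_stepUp)
open NE7BoxPoincareMatrix (boxVec_mem_periodBox boxVec_add_e_mem_iff)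

noncomputable section

variable {d : ℕ}

/-! ## §1 Real bookkeeping and the box chart -/

/-- **WEIGHTED CAUCHY–SCHWARZ AGAINST A GEOMETRIC GAIN**: `(Σ_{t<T} a_t)² ≤ Σ_{t<T} 2^{t+1}·a_t²` (weights `2^{−(t+1)}` sum to `< 1`). [folklore] -/
theorem sq_sum_le_sum_two_pow_mul_sq (T : ℕ) (a : ℕ → ℝ) :
    (∑ t ∈ range T, a t) ^ 2 ≤ ∑ t ∈ range T, 2 ^ (t + 1) * a t ^ 2 := by
  -- Cauchy–Schwarz with `a_t = 2^{−(t+1)∕2}·(2^{(t+1)∕2} a_t)`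
  have h := Finset.sum_mul_sq_le_sq_mul_sq (range T) (fun t => Real.sqrt (((2 : ℝ) ^ (t + 1))⁻¹)) (fun t => Real.sqrt ((2 : ℝ) ^ (t + 1)) * a t)
  have hid : ∀ t ∈ range T, Real.sqrt (((2 : ℝ) ^ (t + 1))⁻¹) * (Real.sqrt ((2 : ℝ) ^ (t + 1)) * a t) = a t := by
    intro t _
    have h2 : (0 : ℝ) < (2 : ℝ) ^ (t + 1) := by positivity
    rw [← mul_assoc, Real.sqrt_inv, inv_mul_cancel₀ (Real.sqrt_ne_zero'.mpr h2), one_mul]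
  have hL : ∑ t ∈ range T, a t = ∑ t ∈ range T, Real.sqrt (((2 : ℝ) ^ (t + 1))⁻¹) * (Real.sqrt ((2 : ℝ) ^ (t + 1)) * a t) :=
    Finset.sum_congr rfl fun t ht => (hid t ht).symm
  have hw : ∑ t ∈ range T, Real.sqrt (((2 : ℝ) ^ (t + 1))⁻¹) ^ 2 ≤ 1 := by
    have e : ∀ t ∈ range T, Real.sqrt (((2 : ℝ) ^ (t + 1))⁻¹) ^ 2 = (1 / 2 : ℝ) ^ (t + 1) := by
      intro t _
      rw [Real.sq_sqrt (by positivity), one_div, inv_pow]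
    rw [Finset.sum_congr rfl e]
    have key : ∀ T' : ℕ, ∑ t ∈ range T', (1 / 2 : ℝ) ^ (t + 1) = 1 - (1 / 2 : ℝ) ^ T' := by
      intro T'
      induction T' with
      | zero => simp
      | succ T' ih => rw [Finset.sum_range_succ, ih, pow_succ]; ring
    rw [key T]
    have h3 : (0 : ℝ) ≤ (1 / 2 : ℝ) ^ T := by positivity
    linarith
  have hv : ∑ t ∈ range T, (Real.sqrt ((2 : ℝ) ^ (t + 1)) * a t) ^ 2 = ∑ t ∈ range T, 2 ^ (t + 1) * a t ^ 2 := by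
    refine Finset.sum_congr rfl fun t _ => ?_
    rw [mul_pow, Real.sq_sqrt (by positivity)]
  rw [hL]
  refine h.trans ?_
  rw [hv]
  have h0 : 0 ≤ ∑ t ∈ range T, (2 : ℝ) ^ (t + 1) * a t ^ 2 := Finset.sum_nonneg fun t _ => by positivity
  nlinarith

/-- **JENSEN FOR THE MEAN**: `|s|·(avg_s u)² ≤ Σ_s u²`. [folklore] -/
theorem sq_avg_mul_card_le {ι : Type*} (s : Finset ι) (u : ι → ℝ) : (s.card : ℝ) * avg s u ^ 2 ≤ ∑ i ∈ s, u i ^ 2 := by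
  rcases s.eq_empty_or_nonempty with hs | hs
  · simp [hs, avg]
  have hc : (0 : ℝ) < s.card := by exact_mod_cast hs.card_pos
  have h := Finset.sum_mul_sq_le_sq_mul_sq s (fun _ => (1 : ℝ)) u
  simp only [one_pow, Finset.sum_const, nsmul_eq_mul, mul_one, one_mul] at h
  unfold avg
  rw [div_pow, ← mul_div_assoc, div_le_iff₀ (by positivity)]
  nlinarith

/-- **A MEAN DIFFERENCE IS A MEAN OF DEVIATIONS**: for `s ⊆ t`, `|s|·(avg_s u − avg_t u)² ≤ Σ_t (u − avg_t u)²`. [folklore] -/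
theorem sq_avg_sub_le {ι : Type*} {s t : Finset ι} (hst : s ⊆ t) (u : ι → ℝ) :
    (s.card : ℝ) * (avg s u - avg t u) ^ 2 ≤ ∑ i ∈ t, (u i - avg t u) ^ 2 := by
  rcases s.eq_empty_or_nonempty with hs | hs
  · simp only [hs, Finset.card_empty, Nat.cast_zero, zero_mul]
    exact Finset.sum_nonneg fun i _ => sq_nonneg _
  have hc : (0 : ℝ) < s.card := by exact_mod_cast hs.card_pos
  have havg : avg s (fun i => u i - avg t u) = avg s u - avg t u := by
    unfold avg
    rw [Finset.sum_sub_distrib, Finset.sum_const, nsmul_eq_mul, sub_div, mul_div_cancel_left₀ _ hc.ne']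
  have h := sq_avg_mul_card_le s (fun i => u i - avg t u)
  rw [havg] at h
  exact h.trans (Finset.sum_le_sum_of_subset_of_nonneg hst fun i _ _ => sq_nonneg _)

/-- Period boxes are nested: `periodBox M ⊆ periodBox M′` for `M ≤ M′`. [folklore] -/
theorem periodBox_mono {M M' : ℕ} (h : M ≤ M') : periodBox (d := d) M ⊆ periodBox (d := d) M' := by
  intro x hx
  rw [mem_periodBox] at hx ⊢
  intro κ
  exact ⟨(hx κ).1, (hx κ).2.trans_le (by exact_mod_cast h)⟩

/-- The box Dirichlet energy is monotone in the box. [folklore] -/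
theorem dirichlet_periodBox_mono {M M' : ℕ} (h : M ≤ M') (u : Site d → ℝ) :
    ∑ x ∈ periodBox (d := d) M, ∑ μ : Fin d, (if x + e μ ∈ periodBox (d := d) M then (u (x + e μ) - u x) ^ 2 else 0)
      ≤ ∑ x ∈ periodBox (d := d) M', ∑ μ : Fin d, (if x + e μ ∈ periodBox (d := d) M' then (u (x + e μ) - u x) ^ 2 else 0) := by
  refine (Finset.sum_le_sum fun x _ => Finset.sum_le_sum fun μ _ => ?_).trans
    (Finset.sum_le_sum_of_subset_of_nonneg (periodBox_mono h) fun x _ _ => Finset.sum_nonneg fun μ _ => by positivity)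
  by_cases hx : x + e μ ∈ periodBox (d := d) M
  · rw [if_pos hx, if_pos (periodBox_mono h hx)]
  · rw [if_neg hx]; positivity

/-- **THE POINCARÉ INEQUALITY ON THE PERIOD BOX, REAL FUNCTIONS**: `Σ_{periodBox (m+1)} (u − avg u)² ≤ (m(m+1)∕2)·𝓔_{m+1}(u)` — the kernel `poincare_coordCube` read through the chart
`boxVec` (cf. `NE7BoxPoincareMatrix.poincare_periodBox_nhs` for matrix fields). [folklore] -/
theorem poincare_periodBox_real (m : ℕ) (u : Site d → ℝ) :
    ∑ x ∈ periodBox (d := d) (m + 1), (u x - avg (periodBox (d := d) (m + 1)) u) ^ 2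
      ≤ (m : ℝ) * (m + 1) / 2 * ∑ x ∈ periodBox (d := d) (m + 1), ∑ μ : Fin d,
          (if x + e μ ∈ periodBox (d := d) (m + 1) then (u (x + e μ) - u x) ^ 2 else 0) := by
  set g : (Fin d → Fin (m + 1)) → ℝ := fun y => u (boxVec (m + 1) y) with hg
  have havg : avg (periodBox (d := d) (m + 1)) u = avg univ g := by
    unfold avg
    rw [sum_periodBox_eq_sum_boxVec (m + 1) (f := u), card_periodBox, Finset.card_univ, Fintype.card_fun, Fintype.card_fin, Fintype.card_fin]
  rw [sum_periodBox_eq_sum_boxVec (m + 1) (f := fun x => (u x - avg (periodBox (d := d) (m + 1)) u) ^ 2),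
    sum_periodBox_eq_sum_boxVec (m + 1) (f := fun x => ∑ μ : Fin d,
      (if x + e μ ∈ periodBox (d := d) (m + 1) then (u (x + e μ) - u x) ^ 2 else 0)), havg]
  have h := poincare_coordCube m d g
  refine h.trans (mul_le_mul_of_nonneg_left (le_of_eq ?_) (by positivity))
  -- rewrite the indicator through the cube chart
  have h1 : ∀ (y : Fin d → Fin (m + 1)) (μ : Fin d), (if boxVec (m + 1) y + e μ ∈ periodBox (d := d) (m + 1)
      then (u (boxVec (m + 1) y + e μ) - u (boxVec (m + 1) y)) ^ 2 else 0)
      = if y μ ≠ Fin.last m then (g (stepUp y μ) - g y) ^ 2 else 0 := by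
    intro y μ
    by_cases hy : y μ ≠ Fin.last m
    · rw [if_pos ((boxVec_add_e_mem_iff y μ).2 hy), if_pos hy]
      simp only [hg, boxVec_stepUp y μ hy]
    · rw [if_neg (fun h' => hy ((boxVec_add_e_mem_iff y μ).1 h')), if_neg hy]
  simp only [h1]
  rw [Finset.sum_comm]
  refine Finset.sum_congr rfl fun μ _ => ?_
  rw [Finset.sum_filter]

/-! ## §2 The local mass near a block corner -/

/-- **THE LOCAL MASS OF A LATTICE FUNCTION NEAR A BLOCK CORNER** (`1 ≤ L`, `4L² ≤ L^d`, `s ≤ S`):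
`Σ_{periodBox (L^s)} u² ≤ 4·(L^s)^d∕(L^S)^d·Σ_{periodBox (L^S)} u² + 20·L²·(L^s)²·𝓔_{L^S}(u)` — k-FREE: the dyadic means telescope against the geometric gain
`2L^{2}∕L^{d} ≤ 1∕2`, no logarithm of the scale ratio. [folklore] -/
theorem cornerLocalMass_le {L : ℕ} (hL : 1 ≤ L) (hLd : 4 * (L : ℝ) ^ 2 ≤ (L : ℝ) ^ d) {s S : ℕ} (hsS : s ≤ S) (u : Site d → ℝ) :
    ∑ x ∈ periodBox (d := d) (L ^ s), u x ^ 2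
      ≤ 4 * (((L : ℝ) ^ s) ^ d / ((L : ℝ) ^ S) ^ d) * ∑ x ∈ periodBox (d := d) (L ^ S), u x ^ 2
        + 20 * (L : ℝ) ^ 2 * ((L : ℝ) ^ s) ^ 2 * ∑ x ∈ periodBox (d := d) (L ^ S), ∑ μ : Fin d,
            (if x + e μ ∈ periodBox (d := d) (L ^ S) then (u (x + e μ) - u x) ^ 2 else 0) := by
  have hL0 : (0 : ℝ) < L := by exact_mod_cast (by omega : 0 < L)
  -- notation: the boxes, the big energy, the scale ratio
  set B : ℕ → Finset (Site d) := fun t => periodBox (d := d) (L ^ t) with hB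
  set E : ℝ := ∑ x ∈ periodBox (d := d) (L ^ S), ∑ μ : Fin d,
      (if x + e μ ∈ periodBox (d := d) (L ^ S) then (u (x + e μ) - u x) ^ 2 else 0) with hE
  have hE0 : 0 ≤ E := Finset.sum_nonneg fun x _ => Finset.sum_nonneg fun μ _ => by positivity
  set q : ℝ := (L : ℝ) ^ 2 / (L : ℝ) ^ d with hq
  have hq0 : 0 ≤ q := by positivity
  have hq2 : 2 * q ≤ 1 / 2 := by
    rw [hq, mul_div_assoc', div_le_iff₀ (by positivity)]; linarith
  have hBmono : ∀ {t t' : ℕ}, t ≤ t' → B t ⊆ B t' := fun h => periodBox_mono (Nat.pow_le_pow_right hL h)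
  have hcard : ∀ t : ℕ, ((B t).card : ℝ) = ((L : ℝ) ^ t) ^ d := fun t => by
    rw [hB]; simp only [card_periodBox]; push_cast; ring
  have hq_pow : ∀ t : ℕ, q ^ t * ((L : ℝ) ^ t) ^ d = ((L : ℝ) ^ t) ^ 2 := fun t => by
    rw [hq, div_pow, ← pow_mul, ← pow_mul, ← pow_mul, ← pow_mul]
    field_simp
    rw [← pow_add, ← pow_add]; congr 1; ring
  -- Poincaré on each box `B t`, `t ≤ S`, against the energy of the big box
  have hP : ∀ t ≤ S, ∑ x ∈ B t, (u x - avg (B t) u) ^ 2 ≤ ((L : ℝ) ^ t) ^ 2 / 2 * E := by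
    intro t ht
    obtain ⟨M, hM⟩ : ∃ M, L ^ t = M + 1 := ⟨L ^ t - 1, (Nat.sub_add_cancel (Nat.one_le_pow _ _ hL)).symm⟩
    have h := poincare_periodBox_real (d := d) M u
    rw [← hM] at h
    refine h.trans ?_
    have hMR : (M : ℝ) = (L : ℝ) ^ t - 1 := by
      have : ((L ^ t : ℕ) : ℝ) = (M : ℝ) + 1 := by exact_mod_cast hM
      push_cast at this; linarith
    have h2 : (M : ℝ) * (M + 1) / 2 ≤ ((L : ℝ) ^ t) ^ 2 / 2 := by rw [hMR]; nlinarith [pow_pos hL0 t]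
    exact (mul_le_mul_of_nonneg_left (dirichlet_periodBox_mono (Nat.pow_le_pow_right hL ht) u) (by positivity)).trans
      (mul_le_mul_of_nonneg_right h2 hE0)
  -- the mean steps: `(m_t − m_{t+1})² ≤ (L²∕2)·q^t·E`
  have hstep : ∀ t, t < S → (avg (B t) u - avg (B (t + 1)) u) ^ 2 ≤ ((L : ℝ) ^ 2 / 2) * q ^ t * E := by
    intro t ht
    have h1 := sq_avg_sub_le (hBmono (Nat.le_succ t)) u
    have h2 := hP (t + 1) ht
    rw [hcard t] at h1
    have h3 : ((L : ℝ) ^ t) ^ d * (avg (B t) u - avg (B (t + 1)) u) ^ 2 ≤ ((L : ℝ) ^ (t + 1)) ^ 2 / 2 * E := h1.trans h2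
    have hpos : (0 : ℝ) < ((L : ℝ) ^ t) ^ d := by positivity
    rw [← le_div_iff₀' hpos] at h3
    refine h3.trans (le_of_eq ?_)
    have e1 : ((L : ℝ) ^ (t + 1)) ^ 2 = (L : ℝ) ^ 2 * (q ^ t * ((L : ℝ) ^ t) ^ d) := by rw [hq_pow t]; ring
    rw [e1]
    field_simp
  -- telescope the means from `s` to `S`
  have htel : avg (B s) u - avg (B S) u = ∑ t ∈ range (S - s), (avg (B (s + t)) u - avg (B (s + t + 1)) u) := by
    have h := Finset.sum_range_sub (fun t => -avg (B (s + t)) u) (S - s)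
    simp only [neg_sub_neg, add_zero] at h
    rw [Nat.add_sub_cancel' hsS] at h
    have e : ∑ t ∈ range (S - s), (avg (B (s + t)) u - avg (B (s + t + 1)) u)
        = ∑ t ∈ range (S - s), (avg (B (s + t)) u - avg (B (s + (t + 1))) u) :=
      Finset.sum_congr rfl fun t _ => by rw [add_assoc]
    rw [e]; linarith [h]
  set D : ℝ := (∑ t ∈ range (S - s), (avg (B (s + t)) u - avg (B (s + t + 1)) u)) ^ 2 with hD
  have hms : (avg (B s) u) ^ 2 ≤ 2 * (avg (B S) u) ^ 2 + 2 * D := by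
    have e : avg (B s) u = avg (B S) u + (avg (B s) u - avg (B S) u) := by ring
    rw [hD, ← htel]
    nlinarith [sq_nonneg (avg (B S) u - (avg (B s) u - avg (B S) u))]
  -- the weighted Cauchy–Schwarz and the geometric series: `D ≤ 2L²·q^s·E`
  have hsumsq : D ≤ 2 * (L : ℝ) ^ 2 * q ^ s * E := by
    refine (sq_sum_le_sum_two_pow_mul_sq (S - s) (fun t => avg (B (s + t)) u - avg (B (s + t + 1)) u)).trans ?_
    have hterm : ∀ t ∈ range (S - s), (2 : ℝ) ^ (t + 1) * (avg (B (s + t)) u - avg (B (s + t + 1)) u) ^ 2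
        ≤ ((L : ℝ) ^ 2 * q ^ s * E) * (2 * q) ^ t := by
      intro t ht
      have hts : s + t < S := by have := Finset.mem_range.mp ht; omega
      have h := hstep (s + t) hts
      have e2 : (2 : ℝ) ^ (t + 1) * (((L : ℝ) ^ 2 / 2) * q ^ (s + t) * E) = ((L : ℝ) ^ 2 * q ^ s * E) * (2 * q) ^ t := by
        rw [pow_add, mul_pow, pow_succ]; ring
      calc (2 : ℝ) ^ (t + 1) * (avg (B (s + t)) u - avg (B (s + t + 1)) u) ^ 2
          ≤ (2 : ℝ) ^ (t + 1) * (((L : ℝ) ^ 2 / 2) * q ^ (s + t) * E) := mul_le_mul_of_nonneg_left h (by positivity)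
        _ = _ := e2
    refine (Finset.sum_le_sum hterm).trans ?_
    rw [← Finset.mul_sum]
    have hgeom : ∑ t ∈ range (S - s), (2 * q) ^ t ≤ 2 := by
      have hlt : 2 * q < 1 := by linarith
      have h := geom_sum_eq (x := 2 * q) hlt.ne (S - s)
      rw [h]
      have hden : 2 * q - 1 < 0 := by linarith
      rw [div_le_iff_of_neg hden]
      have : 0 ≤ (2 * q) ^ (S - s) := by positivity
      nlinarith
    have hc0 : 0 ≤ (L : ℝ) ^ 2 * q ^ s * E := by positivity
    calc ((L : ℝ) ^ 2 * q ^ s * E) * ∑ t ∈ range (S - s), (2 * q) ^ t ≤ ((L : ℝ) ^ 2 * q ^ s * E) * 2 :=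
          mul_le_mul_of_nonneg_left hgeom hc0
      _ = 2 * (L : ℝ) ^ 2 * q ^ s * E := by ring
  -- assemble
  have hPs := hP s hsS
  set A : ℝ := ∑ x ∈ B s, u x ^ 2 with hA
  set V : ℝ := ∑ x ∈ B S, u x ^ 2 with hV
  set c : ℝ := ((L : ℝ) ^ s) ^ d with hc
  have hc0 : 0 < c := by rw [hc]; positivity
  have hsplit : A ≤ 2 * ∑ x ∈ B s, (u x - avg (B s) u) ^ 2 + 2 * c * (avg (B s) u) ^ 2 := by
    have e : ∀ x ∈ B s, u x ^ 2 ≤ 2 * (u x - avg (B s) u) ^ 2 + 2 * (avg (B s) u) ^ 2 :=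
      fun x _ => by nlinarith [sq_nonneg (u x - 2 * avg (B s) u)]
    refine (Finset.sum_le_sum e).trans (le_of_eq ?_)
    rw [Finset.sum_add_distrib, ← Finset.mul_sum, Finset.sum_const, nsmul_eq_mul, hcard s]; ring
  have hvol : c * (avg (B S) u) ^ 2 ≤ (c / ((L : ℝ) ^ S) ^ d) * V := by
    have h := sq_avg_mul_card_le (B S) u
    rw [hcard S] at h
    have hS0 : (0 : ℝ) < ((L : ℝ) ^ S) ^ d := by positivity
    rw [div_mul_eq_mul_div, le_div_iff₀ hS0]
    calc c * (avg (B S) u) ^ 2 * ((L : ℝ) ^ S) ^ d = c * (((L : ℝ) ^ S) ^ d * avg (B S) u ^ 2) := by ring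
      _ ≤ c * V := mul_le_mul_of_nonneg_left h hc0.le
  have hcD : c * D ≤ 2 * (L : ℝ) ^ 2 * ((L : ℝ) ^ s) ^ 2 * E := by
    have h := mul_le_mul_of_nonneg_left hsumsq hc0.le
    have e : c * (2 * (L : ℝ) ^ 2 * q ^ s * E) = 2 * (L : ℝ) ^ 2 * (q ^ s * ((L : ℝ) ^ s) ^ d) * E := by rw [hc]; ring
    rw [e, hq_pow s] at h
    exact h
  have hcms : c * (avg (B s) u) ^ 2 ≤ 2 * (c * (avg (B S) u) ^ 2) + 2 * (c * D) := by
    have h := mul_le_mul_of_nonneg_left hms hc0.le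
    linarith
  have hL1 : (1 : ℝ) ≤ (L : ℝ) ^ 2 := by
    have : (1 : ℝ) ≤ L := by exact_mod_cast hL
    nlinarith
  have hX0 : 0 ≤ ((L : ℝ) ^ s) ^ 2 * E := by positivity
  have hratio : c / ((L : ℝ) ^ S) ^ d = ((L : ℝ) ^ s) ^ d / ((L : ℝ) ^ S) ^ d := by rw [hc]
  rw [← hratio]
  nlinarith [hsplit, hPs, hvol, hcD, hcms, hX0, hL1]


/-! ## §3 (appended, gen 96) The covariant form for matrix fields: local mass against the COVARIANT gradient energy -/

open scoped Matrix Matrix.Norms.L2Operator in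
open T4AveragingDeficitWall (Ad IsUnitaryCfg dirSq) in
open AveragingDeficitTransport (norm_Ad_of_unitary) in
/-- **THE LOCAL MASS OF A MATRIX FIELD NEAR A BLOCK CORNER, AGAINST ITS COVARIANT GRADIENT ENERGY** (`W` unitary, `1 ≤ L`, `4L² ≤ L^d`, `s ≤ S`):
`dirSq Z (periodBox (L^s)) ≤ 4·(L^s)^d∕(L^S)^d·dirSq Z (periodBox (L^S)) + 20·L²·(L^s)²·Σ_{x ∈ periodBox (L^S)} Σ_μ 𝟙(x+e_μ ∈ box) Σ_κ ‖Ad_{W(x+e_κ,μ)} Z(x+e_μ,κ) − Z(x,κ)‖²`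
— `cornerLocalMass_le` applied to the real functions `u_κ = ‖Z(·,κ)‖`, whose plain differences are bounded by the COVARIANT differences of `Z` (reverse triangle inequality and
`‖Ad_w a‖ = ‖a‖` for unitary `w`; the summand is `‖NE3.PairLandauB8.covDiff W μ Z x κ‖²`).  The form ROAD-Γ's (Γ4) consumes (memo §10(ii)). [folklore] -/
theorem cornerLocalMass_covariant_le {n : Type*} [Fintype n] [DecidableEq n] [Nonempty n] {L : ℕ} (hL : 1 ≤ L) (hLd : 4 * (L : ℝ) ^ 2 ≤ (L : ℝ) ^ d)
    {s S : ℕ} (hsS : s ≤ S) {W : Site d → Fin d → (Matrix n n ℂ)ˣ} (hW : IsUnitaryCfg W) (Z : Site d → Fin d → Matrix n n ℂ) :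
    dirSq Z (periodBox (d := d) (L ^ s))
      ≤ 4 * (((L : ℝ) ^ s) ^ d / ((L : ℝ) ^ S) ^ d) * dirSq Z (periodBox (d := d) (L ^ S))
        + 20 * (L : ℝ) ^ 2 * ((L : ℝ) ^ s) ^ 2 * ∑ x ∈ periodBox (d := d) (L ^ S), ∑ μ : Fin d,
            (if x + e μ ∈ periodBox (d := d) (L ^ S) then ∑ κ : Fin d, ‖Ad (W (x + e κ) μ) (Z (x + e μ) κ) - Z x κ‖ ^ 2 else 0) := by
  letI : CStarAlgebra (Matrix n n ℂ) := {}
  -- per component `κ`, the scalar local mass of `u_κ = ‖Z(·,κ)‖`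
  have hκ : ∀ κ : Fin d, ∑ x ∈ periodBox (d := d) (L ^ s), ‖Z x κ‖ ^ 2
      ≤ 4 * (((L : ℝ) ^ s) ^ d / ((L : ℝ) ^ S) ^ d) * ∑ x ∈ periodBox (d := d) (L ^ S), ‖Z x κ‖ ^ 2
        + 20 * (L : ℝ) ^ 2 * ((L : ℝ) ^ s) ^ 2 * ∑ x ∈ periodBox (d := d) (L ^ S), ∑ μ : Fin d,
            (if x + e μ ∈ periodBox (d := d) (L ^ S) then ‖Ad (W (x + e κ) μ) (Z (x + e μ) κ) - Z x κ‖ ^ 2 else 0) := by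
    intro κ
    have h := cornerLocalMass_le (d := d) hL hLd hsS (fun x => ‖Z x κ‖)
    refine h.trans (add_le_add le_rfl (mul_le_mul_of_nonneg_left ?_ (by positivity)))
    refine Finset.sum_le_sum fun x _ => Finset.sum_le_sum fun μ _ => ?_
    by_cases hx : x + e μ ∈ periodBox (d := d) (L ^ S)
    · rw [if_pos hx, if_pos hx]
      -- `(‖a‖ − ‖b‖)² ≤ ‖Ad_w a − b‖²` with `‖Ad_w a‖ = ‖a‖`
      have h1 : |‖Z (x + e μ) κ‖ - ‖Z x κ‖| ≤ ‖Ad (W (x + e κ) μ) (Z (x + e μ) κ) - Z x κ‖ := by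
        rw [← norm_Ad_of_unitary (hW (x + e κ) μ) (Z (x + e μ) κ)]
        exact abs_norm_sub_norm_le _ _
      have h2 := sq_le_sq' (abs_le.mp h1).1 (abs_le.mp h1).2
      exact h2
    · rw [if_neg hx, if_neg hx]
  -- sum over the components
  unfold dirSq
  rw [Finset.sum_comm, Finset.sum_comm (s := periodBox (d := d) (L ^ S))]
  refine (Finset.sum_le_sum fun κ _ => hκ κ).trans (le_of_eq ?_)
  rw [Finset.sum_add_distrib, ← Finset.mul_sum, ← Finset.mul_sum]
  congr 1
  congr 1
  rw [Finset.sum_comm]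
  refine Finset.sum_congr rfl fun x _ => ?_
  rw [Finset.sum_comm]
  refine Finset.sum_congr rfl fun μ _ => ?_
  by_cases hx : x + e μ ∈ periodBox (d := d) (L ^ S)
  · simp only [if_pos hx]
  · simp only [if_neg hx, Finset.sum_const_zero]

end

end Summit.QuantumFields.BalabanUV.T4Continuum.NE7CornerLocalMass
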